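import Literature.Probability.LatticeModels.GibbsTailDisintegration
import Literature.Probability.Process.BackwardCondExpConvergence
import HarnessLib

/-!
# Almost every conditional Gibbs measure given the tail σ-algebra is tail trivial

Topic `Probability/LatticeModels`, generic specifications on a countable site set with standard
Borel spins. Third infrastructure file toward the Aizenman–Higuchi theorem along Georgii–Higuchi
2000 (§2, p. 3: "the extremal decomposition"). With `π = condExpKernel μ 𝒯` the conditional
probability kernel of a Gibbs measure `μ ∈ 𝒢(γ)` given the tail σ-algebra `𝒯`
(`GibbsTailDisintegration`: `μ = ∫ π^ω μ(dω)` and `π^ω ∈ 𝒢(γ)` a.s.), this file proves the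
second half of Georgii 2011, Thm. 7.26: **`π^ω` is trivial on `𝒯` for `μ`-a.e. `ω`**
(`IsGibbsMeasure.ae_isTailTrivial_condExpKernel_tail`). Hence every Gibbs measure is an integral
of tail-trivial Gibbs measures.

## Proof (Georgii 2011, Props. 7.22, 7.25 and Thm. 7.26, with the backward martingale theorem)

Fix an exhausting sequence of finite volumes `Λ_n ↑ V` (so `𝒯 = ⨅_n 𝓕_{Λ_nᶜ}`) and a countable
π-system `𝒞` generating the product σ-algebra.
1. (`ae_ae_condExpKernel_tail_apply_eq`) For every event `A`, for `μ`-a.e. `ω` the tail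
   measurable function `π(·)(A)` is `π^ω`-a.s. equal to the constant `π^ω(A)`: its sub-level sets
   at rational heights are tail events, on which `π^ω` is `0`–`1` according to `ω`
   (`condExpKernel_tail_apply_ae_eq_indicator`).
2. For `A ∈ 𝒞`, `γ_{Λ_n}(A|·) = μ(A|𝓕_{Λ_nᶜ}) → μ(A|𝒯) = π(·)(A)` `μ`-a.s. along a subsequence
   (Lévy's downward theorem, `Process.exists_strictMono_ae_tendsto_condExp_antitone`), hence also
   `π^ω`-a.s. for `μ`-a.e. `ω` (a `μ`-null set is `π^ω`-null for a.e. `ω`).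
3. For such `ω`, `ν = π^ω ∈ 𝒢(γ)` and `B ∈ 𝒯`: `ν(A ∩ B) = ∫_B γ_{Λ_n}(A|·) dν → ∫_B π(·)(A) dν
   = π^ω(A) ν(B) = ν(A) ν(B)` (DLR and properness; dominated convergence; step 1). The two finite
   measures `ν(· ∩ B)` and `ν(B) ν` agree on `𝒞`, hence everywhere; at `B` this gives
   `ν(B) = ν(B)²`, i.e. `ν(B) ∈ {0, 1}`.

## References

* H.-O. Georgii, *Gibbs Measures and Phase Transitions*, 2nd ed., de Gruyter 2011, §7.3,
  Prop. 7.25 and Thm. 7.26 [Georgii2011].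
* H.-O. Georgii, Y. Higuchi, J. Math. Phys. 41 (2000) 1153–1169, §2, p. 3 [GeorgiiHiguchi2000].
* R. Durrett, *Probability: Theory and Examples*, CUP 2019, Thm. 4.7.3 [Durrett2019].
-/

noncomputable section

open MeasureTheory ProbabilityTheory Filter
open scoped ENNReal ProbabilityTheory Topology

namespace Literature.Probability.LatticeModels

/-! ### Two countability tools -/

/-- A countably generated measurable space admits a **countable π-system of measurable sets,
containing the whole space, which generates the σ-algebra** (finite intersections of a countable
generating family). [folklore] -/
theorem exists_countable_isPiSystem_generateFrom (α : Type*) [m : MeasurableSpace α]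
    [h : MeasurableSpace.CountablyGenerated α] :
    ∃ C : Set (Set α), C.Countable ∧ IsPiSystem C ∧ MeasurableSpace.generateFrom C = m ∧
      (∀ s ∈ C, MeasurableSet s) ∧ Set.univ ∈ C := by
  obtain ⟨b, hbc, hb⟩ := h.isCountablyGenerated
  have hbm : ∀ s ∈ b, MeasurableSet s := fun s hs => by
    rw [hb]; exact MeasurableSpace.measurableSet_generateFrom hs
  refine ⟨(fun t : Set (Set α) => ⋂₀ t) '' {t | t.Finite ∧ t ⊆ b},
    (Set.countable_setOf_finite_subset hbc).image _, ?_, ?_, ?_, ?_⟩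
  · rintro _ ⟨t₁, ⟨ht₁f, ht₁b⟩, rfl⟩ _ ⟨t₂, ⟨ht₂f, ht₂b⟩, rfl⟩ -
    exact ⟨t₁ ∪ t₂, ⟨ht₁f.union ht₂f, Set.union_subset ht₁b ht₂b⟩, Set.sInter_union _ _⟩
  · refine le_antisymm (MeasurableSpace.generateFrom_le ?_) ?_
    · rintro _ ⟨t, ⟨htf, htb⟩, rfl⟩
      exact htf.measurableSet_sInter fun s hs => hbm s (htb hs)
    · rw [hb]
      refine MeasurableSpace.generateFrom_mono fun s hs => ?_
      exact ⟨{s}, ⟨Set.finite_singleton s, Set.singleton_subset_iff.2 hs⟩, Set.sInter_singleton s⟩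
  · rintro _ ⟨t, ⟨htf, htb⟩, rfl⟩
    exact htf.measurableSet_sInter fun s hs => hbm s (htb hs)
  · exact ⟨∅, ⟨Set.finite_empty, Set.empty_subset _⟩, Set.sInter_empty⟩

/-- A countable site set is **exhausted by an increasing sequence of finite volumes**
`Λ 0 ⊆ Λ 1 ⊆ ⋯` (every finite set lies in some `Λ n`) (Georgii 2011, §7.3, the cofinal sequence
in the definition of the limit kernel). [folklore] -/
theorem exists_monotone_finset_exhaustion (V : Type*) [Countable V] :
    ∃ Λ : ℕ → Finset V, Monotone Λ ∧ ∀ Δ : Finset V, ∃ n, Δ ⊆ Λ n := by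
  classical
  obtain ⟨f, hf⟩ := exists_injective_nat V
  refine ⟨fun n => (Finset.range n).preimage f (hf.injOn.mono (Set.subset_univ _)),
    fun n k hnk x hx => ?_, fun Δ => ⟨Δ.sup f + 1, fun x hx => ?_⟩⟩
  · simp only [Finset.mem_preimage, Finset.mem_range] at hx ⊢
    exact hx.trans_le hnk
  · simp only [Finset.mem_preimage, Finset.mem_range]
    exact Nat.lt_succ_of_le (Finset.le_sup hx)

variable {V S : Type*} [MeasurableSpace S]

/-- Along an exhausting sequence of finite volumes the tail σ-algebra is the countable
intersection `𝒯 = ⨅_n 𝓕_{Λ_nᶜ}` (cofinality) (Georgii 2011, §7.3). [cite: Georgii2011, Thm. 7.26] -/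
theorem tailEvents_eq_iInf_of_exhaustion {Λ : ℕ → Finset V} (hΛ : ∀ Δ : Finset V, ∃ n, Δ ⊆ Λ n) :
    tailEvents V S = ⨅ n, cylinderEvents (X := fun _ : V => S) ((↑(Λ n) : Set V)ᶜ) := by
  refine le_antisymm (le_iInf fun n => tailEvents_le_cylinderEvents (Λ n)) (le_iInf fun Δ => ?_)
  obtain ⟨n, hn⟩ := hΛ Δ
  exact (iInf_le _ n).trans
    (cylinderEvents_mono (Set.compl_subset_compl.2 (Finset.coe_subset.2 hn)))

/-! ### DLR equations integrated over an outside event -/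

variable {γ : Specification V S}

/-- For `ν ∈ 𝒢(γ)`, measurable `A` and `B ∈ 𝓕_{Λᶜ}`: `∫_B γ_Λ(A|·) dν = ν(A ∩ B)` (properness
and the DLR equation; Georgii 2011, Rem. 1.24 with Rem. 1.20). [cite: Georgii2011, Def. 1.23 / Rem. 1.24] -/
theorem IsGibbsMeasure.setLIntegral_spec_eq (hγ : IsSpecification γ) {ν : Measure (V → S)}
    (hν : IsGibbsMeasure γ ν) (Λ : Finset V) {A B : Set (V → S)} (hA : MeasurableSet A)
    (hB : MeasurableSet[cylinderEvents (X := fun _ : V => S) ((↑Λ : Set V)ᶜ)] B) :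
    ∫⁻ η in B, γ Λ η A ∂ν = ν (A ∩ B) := by
  have hBm : MeasurableSet B := cylinderEvents_le_pi _ hB
  have hind : ∀ η, B.indicator (fun η => γ Λ η A) η = γ Λ η (A ∩ B) := by
    intro η
    rw [hγ.measure_inter_of_cylinderEvents Λ A hB η]
    by_cases hη : η ∈ B
    · simp [Set.indicator_of_mem hη]
    · simp [Set.indicator_of_notMem hη]
  rw [← lintegral_indicator hBm]
  simp_rw [hind]
  exact hν.2 Λ (A ∩ B) (hA.inter hBm)

/-! ### The tail kernel is almost surely constant on itself -/

section Kernel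

variable [Countable V] [StandardBorelSpace S] (μ : Measure (V → S)) [IsFiniteMeasure μ]

/-- **`π(·)(A)` is `π^ω`-a.s. equal to `π^ω(A)`, for `μ`-a.e. `ω`** (Georgii 2011, proof of
Prop. 7.25: `π(π(A|·) = π(A|ω) | ω) = 1`). Proof: for rational `q` the sub-level set
`B_q = {π(·)(A) ≤ q}` is a tail event, so `π^ω(B_q) = 1_{B_q}(ω)` a.s.
(`condExpKernel_tail_apply_ae_eq_indicator`); off these countably many null events,
`π^{ω'}(A) ≠ π^ω(A)` would put `ω'` and `ω` on different sides of some level `q`. [cite: Georgii2011, Prop. 7.25] -/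
theorem ae_ae_condExpKernel_tail_apply_eq {A : Set (V → S)} (hA : MeasurableSet A) :
    ∀ᵐ ω ∂μ, ∀ᵐ ω' ∂(condExpKernel μ (tailEvents V S) ω),
      condExpKernel μ (tailEvents V S) ω' A = condExpKernel μ (tailEvents V S) ω A := by
  classical
  set π := condExpKernel μ (tailEvents V S) with hπ
  have hg : Measurable[tailEvents V S] fun ω => π ω A := measurable_condExpKernel hA
  -- rational sub-level sets are tail events
  let L : ℚ → Set (V → S) := fun q => (fun ω => π ω A) ⁻¹' Set.Iic (ENNReal.ofReal q)
  have hL : ∀ q, MeasurableSet[tailEvents V S] (L q) := fun q => hg measurableSet_Iic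
  have hae : ∀ᵐ ω ∂μ, ∀ q, π ω (L q) = (L q).indicator 1 ω :=
    ae_all_iff.2 fun q => condExpKernel_tail_apply_ae_eq_indicator μ (hL q)
  filter_upwards [hae] with ω hω
  -- the exceptional set is covered by countably many `π^ω`-null sets
  let N : ℚ → Set (V → S) := fun q => if ω ∈ L q then (L q)ᶜ else L q
  have hN : ∀ q, π ω (N q) = 0 := by
    intro q
    by_cases hq : ω ∈ L q
    · rw [show N q = (L q)ᶜ from if_pos hq,
        prob_compl_eq_zero_iff (MeasurableSet.of_tailEvents (hL q)), hω q,
        Set.indicator_of_mem hq, Pi.one_apply]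
    · rw [show N q = L q from if_neg hq, hω q, Set.indicator_of_notMem hq]
  have hcover : {ω' | π ω' A ≠ π ω A} ⊆ ⋃ q, N q := by
    intro ω' hω'
    rcases lt_or_gt_of_ne hω' with hlt | hgt
    · obtain ⟨q, -, h1, h2⟩ := ENNReal.lt_iff_exists_rat_btwn.1 hlt
      refine Set.mem_iUnion.2 ⟨q, ?_⟩
      have hω'q : ω' ∈ L q := le_of_lt h1
      have hωq : ω ∉ L q := fun h => (not_le.2 h2) h
      rw [show N q = L q from if_neg hωq]
      exact hω'q
    · obtain ⟨q, -, h1, h2⟩ := ENNReal.lt_iff_exists_rat_btwn.1 hgt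
      refine Set.mem_iUnion.2 ⟨q, ?_⟩
      have hωq : ω ∈ L q := le_of_lt h1
      have hω'q : ω' ∉ L q := fun h => (not_le.2 h2) h
      rw [show N q = (L q)ᶜ from if_pos hωq]
      exact hω'q
  have hnull : π ω {ω' | π ω' A ≠ π ω A} = 0 :=
    measure_mono_null hcover (measure_iUnion_null hN)
  rw [ae_iff]
  exact hnull

/-- A `μ`-null set is `π^ω`-null for `μ`-a.e. `ω` (barycentre formula `μ = ∫ π^ω μ(dω)`,
Georgii 2011, Thm. 7.26). [cite: Georgii2011, Thm. 7.26] -/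
theorem ae_condExpKernel_tail_null {N : Set (V → S)} (hN : MeasurableSet N) (hμN : μ N = 0) :
    ∀ᵐ ω ∂μ, condExpKernel μ (tailEvents V S) ω N = 0 := by
  have hm : tailEvents V S ≤ (MeasurableSpace.pi : MeasurableSpace (V → S)) := tailEvents_le_pi
  have hmeas : Measurable (condExpKernel μ (tailEvents V S) : (V → S) → Measure (V → S)) :=
    (condExpKernel μ (tailEvents V S)).measurable.mono hm le_rfl
  have h : ∫⁻ ω, condExpKernel μ (tailEvents V S) ω N ∂μ = 0 := by
    rw [← Measure.bind_apply hN hmeas.aemeasurable, bind_condExpKernel_tail μ, hμN]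
  exact (lintegral_eq_zero_iff ((measurable_condExpKernel hN).mono hm le_rfl)).1 h

/-- If a property holds `μ`-a.e., then for `μ`-a.e. `ω` it holds `π^ω`-a.e.
(Georgii 2011, Thm. 7.26, barycentre formula). [cite: Georgii2011, Thm. 7.26] -/
theorem ae_ae_condExpKernel_tail_of_ae {p : (V → S) → Prop} (hp : ∀ᵐ ω ∂μ, p ω) :
    ∀ᵐ ω ∂μ, ∀ᵐ ω' ∂(condExpKernel μ (tailEvents V S) ω), p ω' := by
  obtain ⟨N, hNsub, hNm, hμN⟩ := exists_measurable_superset_of_null (ae_iff.1 hp)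
  filter_upwards [ae_condExpKernel_tail_null μ hNm hμN] with ω hω
  rw [ae_iff]
  exact measure_mono_null hNsub hω

end Kernel

/-! ### Almost sure tail triviality of the conditional measures -/

section Triviality

variable [Countable V] [StandardBorelSpace S] {μ : Measure (V → S)} [IsFiniteMeasure μ]

/-- **Extremal decomposition, tail-triviality half** (Georgii 2011, Thm. 7.26 with Prop. 7.25;
the background fact "extremal decomposition" of Georgii–Higuchi 2000, §2, p. 3): for a Gibbs
measure `μ ∈ 𝒢(γ)` of a specification on a countable site set with standard Borel spins, the
conditional measures `π^ω = condExpKernel μ 𝒯 ω` are trivial on the tail σ-algebra `𝒯` for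
`μ`-almost every `ω`. Together with `IsGibbsMeasure.ae_isGibbsMeasure_condExpKernel_tail` and
`bind_condExpKernel_tail` (`μ = ∫ π^ω μ(dω)`) this represents every Gibbs measure as a mixture
of tail-trivial Gibbs measures. Proof in the module docstring (Lévy's downward theorem along an
exhausting sequence of volumes, a countable generating π-system, DLR, dominated convergence). [cite: Georgii2011, Thm. 7.26] -/
theorem IsGibbsMeasure.ae_isTailTrivial_condExpKernel_tail (hγ : IsSpecification γ)
    (hμ : IsGibbsMeasure γ μ) :
    ∀ᵐ ω ∂μ, IsTailTrivial (condExpKernel μ (tailEvents V S) ω) := by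
  set π := condExpKernel μ (tailEvents V S) with hπ
  have hm : tailEvents V S ≤ (MeasurableSpace.pi : MeasurableSpace (V → S)) := tailEvents_le_pi
  -- exhausting volumes and the decreasing sequence of outside σ-algebras
  obtain ⟨Λ, hΛmono, hΛex⟩ := exists_monotone_finset_exhaustion V
  set ℱ : ℕ → MeasurableSpace (V → S) :=
    fun n => cylinderEvents (X := fun _ : V => S) ((↑(Λ n) : Set V)ᶜ) with hℱ
  have hℱanti : Antitone ℱ := fun n k hnk =>
    cylinderEvents_mono (Set.compl_subset_compl.2 (Finset.coe_subset.2 (hΛmono hnk)))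
  have hℱle : ∀ n, ℱ n ≤ (MeasurableSpace.pi : MeasurableSpace (V → S)) := fun n =>
    cylinderEvents_le_pi
  have hℱinf : (⨅ n, ℱ n) = tailEvents V S := (tailEvents_eq_iInf_of_exhaustion hΛex).symm
  -- a countable generating π-system
  obtain ⟨C, hCc, hCpi, hCgen, hCm, hCuniv⟩ := exists_countable_isPiSystem_generateFrom (V → S)
  -- Step A: for `A ∈ C`, `γ_{Λ (φ j)}(A|·) → π(·)(A)` a.e. along a subsequence
  have hconv : ∀ A ∈ C, ∃ φ : ℕ → ℕ, StrictMono φ ∧ ∀ᵐ ω ∂μ,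
      Tendsto (fun j => γ (Λ (φ j)) ω A) atTop (𝓝 (π ω A)) := by
    intro A hAC
    have hA : MeasurableSet A := hCm A hAC
    set f : (V → S) → ℝ := A.indicator fun _ => (1 : ℝ) with hf
    have hf_meas : Measurable f := measurable_const.indicator hA
    have hf_bdd : ∀ σ, |f σ| ≤ 1 := fun σ => by
      by_cases hσ : σ ∈ A <;> simp [hf, hσ]
    have hf_int : Integrable f μ := (integrable_const 1).mono' hf_meas.aestronglyMeasurable
      (ae_of_all _ fun σ => by rw [Real.norm_eq_abs]; exact hf_bdd σ)
    obtain ⟨φ, hφ, hlim⟩ :=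
      Literature.Probability.Process.exists_strictMono_ae_tendsto_condExp_antitone hℱanti hℱle
        hf_int (ae_of_all _ hf_bdd)
    refine ⟨φ, hφ, ?_⟩
    have hterm : ∀ n, μ[f|ℱ n] =ᵐ[μ] fun η => (γ (Λ n) η A).toReal := by
      intro n
      filter_upwards [hμ.condExp_ae_eq_integral hγ (Λ n) hf_meas hf_bdd] with η hη
      rw [hη]
      have h1 : ∫ σ, f σ ∂(γ (Λ n) η) = (γ (Λ n) η).real A := integral_indicator_one hA
      rw [h1, measureReal_def]
    have hlimit : μ[f|⨅ n, ℱ n] =ᵐ[μ] fun ω => (π ω A).toReal := by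
      rw [hℱinf]
      filter_upwards [condExpKernel_ae_eq_condExp hm hA (μ := μ)] with ω hω
      rw [← hω, measureReal_def]
    have hall : ∀ᵐ ω ∂μ, ∀ n, (μ[f|ℱ n]) ω = (γ (Λ n) ω A).toReal := ae_all_iff.2 hterm
    filter_upwards [hlim, hall, hlimit] with ω hω hωn hω'
    have hreal : Tendsto (fun j => (γ (Λ (φ j)) ω A).toReal) atTop (𝓝 ((π ω A).toReal)) := by
      have h1 : (fun j => (μ[f|ℱ (φ j)]) ω) = fun j => (γ (Λ (φ j)) ω A).toReal :=
        funext fun j => hωn (φ j)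
      rw [← h1, ← hω']
      exact hω
    refine (ENNReal.tendsto_toReal_iff (fun j => ?_) (measure_ne_top _ _)).1 hreal
    haveI := hγ.isProbability (Λ (φ j)) ω
    exact measure_ne_top _ _
  choose! φ hφ hφconv using hconv
  -- Step B: collect the almost sure properties of `π^ω`
  have hae1 : ∀ᵐ ω ∂μ, IsGibbsMeasure γ (π ω) := hμ.ae_isGibbsMeasure_condExpKernel_tail hγ
  have hae2 : ∀ᵐ ω ∂μ, ∀ A ∈ C, ∀ᵐ ω' ∂(π ω), π ω' A = π ω A :=
    (ae_ball_iff hCc).2 fun A hAC => ae_ae_condExpKernel_tail_apply_eq μ (hCm A hAC)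
  have hae3 : ∀ᵐ ω ∂μ, ∀ A ∈ C, ∀ᵐ ω' ∂(π ω),
      Tendsto (fun j => γ (Λ (φ A j)) ω' A) atTop (𝓝 (π ω' A)) :=
    (ae_ball_iff hCc).2 fun A hAC => ae_ae_condExpKernel_tail_of_ae μ (hφconv A hAC)
  filter_upwards [hae1, hae2, hae3] with ω hG h2 h3
  -- Step C: `ν = π^ω` factorises on `C × 𝒯`
  intro B hB
  have hBm : MeasurableSet B := hm _ hB
  have hkey : ∀ A ∈ C, π ω (A ∩ B) = π ω A * π ω B := by
    intro A hAC
    have hA : MeasurableSet A := hCm A hAC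
    have hDLR : ∀ j, ∫⁻ η in B, γ (Λ (φ A j)) η A ∂(π ω) = π ω (A ∩ B) := fun j =>
      hG.setLIntegral_spec_eq hγ (Λ (φ A j)) hA (tailEvents_le_cylinderEvents (Λ (φ A j)) _ hB)
    have hlim : Tendsto (fun j => ∫⁻ η in B, γ (Λ (φ A j)) η A ∂(π ω)) atTop
        (𝓝 (∫⁻ η in B, π η A ∂(π ω))) := by
      refine tendsto_lintegral_of_dominated_convergence (fun _ => 1)
        (fun j => hγ.measurable_coe (Λ (φ A j)) hA) (fun j => ae_of_all _ fun η => ?_) ?_ ?_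
      · haveI := hγ.isProbability (Λ (φ A j)) η
        exact prob_le_one
      · rw [lintegral_const, one_mul]
        exact measure_ne_top _ _
      · exact ae_restrict_of_ae (h3 A hAC)
    have hlhs : ∫⁻ η in B, π η A ∂(π ω) = π ω (A ∩ B) := by
      refine tendsto_nhds_unique hlim ?_
      simp_rw [hDLR]
      exact tendsto_const_nhds
    have hrhs : ∫⁻ η in B, π η A ∂(π ω) = π ω A * π ω B := by
      rw [lintegral_congr_ae (ae_restrict_of_ae (h2 A hAC)), setLIntegral_const]
    rw [← hlhs, hrhs]
  -- Step D: extend to all events and conclude at `A = B`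
  have hext : (π ω).restrict B = (π ω B) • (π ω) := by
    refine ext_of_generate_finite C hCgen.symm hCpi (fun A hAC => ?_) ?_
    · rw [Measure.restrict_apply (hCm A hAC), Measure.smul_apply, smul_eq_mul, hkey A hAC,
        mul_comm]
    · rw [Measure.restrict_apply MeasurableSet.univ, Set.univ_inter, Measure.smul_apply,
        smul_eq_mul, measure_univ, mul_one]
  have hBB : π ω B = π ω B * π ω B := by
    have h := congrArg (fun ν : Measure (V → S) => ν B) hext
    simp only [Measure.restrict_apply hBm, Set.inter_self, Measure.smul_apply, smul_eq_mul] at h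
    exact h
  by_cases h0 : π ω B = 0
  · exact Or.inl h0
  · right
    have h1 : π ω B * 1 = π ω B * π ω B := by rwa [mul_one]
    exact ((ENNReal.mul_right_inj h0 (measure_ne_top _ _)).1 h1).symm

end Triviality

end Literature.Probability.LatticeModels
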